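import Literature.Analysis.FluidPDE.GCLMSelfSimilarBlowup
import HarnessLib

/-!
# The parabolic (`c_l = 1/2`) exactly self-similar ansatz of the VISCOUS gCLM on the line: a profile of the
# steady dynamic-rescaling equation with constant viscosity gives an exact self-similar classical solution of
# `ω_t + a u ω_x = u_x ω + ν ω_xx` that blows up (Chen 2020, §2.1, the case `c_ω + 2c_l = 0`)

HONEST FRAMING (cell ns-blowup GROUP B «PROFILE SEARCH», zone Z3 = SHEET-ℝ, the `E½` rows: exactly self-similar
VISCOUS gCLM profiles at `c_l = 1/2`): **1-D MODEL (viscous gCLM/OSW), not Euler/NS.** No profile is asserted to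
exist here: this file proves the IMPLICATION «profile ⇒ exact self-similar viscous blow-up», the statement each
«CANDIDATE (MODEL)» `E½` row would instantiate if its profile were certified.

Analysis/FluidPDE PROOF file (no named fact; one predicate with arguments). Source of the computation:
[Chen2020DissipativeGCLM] §2.1: the dynamic-rescaling system (2.2)
`ω_τ + (c_l x + a u)ω_x = (c_ω + u_x)ω + ν(τ)ω_xx`, `ν(τ) = C_l(τ)^{−2}C_ω(τ)ν = exp(∫₀^τ (c_ω + 2c_l))·C_l(0)^{−2}C_ω(0)ν`
(2.3), whose steady states are exactly self-similar solutions of (1.1) ("If `(ω̃, c_l, c_ω)` converges to a steady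
state … one can verify that `ω = (1−t)⁻¹ ω_∞(x/(1−t)^{−c_{l,∞}/c_{ω,∞}})` is a self-similar solution"). With the
normalisation `c_ω = −1` the rescaled viscosity `ν(τ)` is CONSTANT iff `c_ω + 2c_l = 0`, i.e. `c_l = 1/2` — the
parabolic scaling of §1.2 (`ω_λ(x,t) = λ^γω(λx, λ^γt)`, `γ = 2`). The steady equation at `(c_l, c_ω) = (1/2, −1)`:

  `(X/2 + a U(X))·Ω′(X) = (−1 + HΩ(X))·Ω(X) + ν Ω″(X)`,  `U = ∫₀^X HΩ`.                            (Pν)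

* `ViscousGCLMProfileEqAt a ν Ω X` — (Pν) at the point `X` (definition with body); at `ν = 0` it is
  `GCLMProfileEqAt a (1/2) (−1) Ω X` (`viscousGCLMProfileEqAt_zero_iff`).
* `isGCLMLineSolution_viscousSelfSimilar` — **(Pν) ⇒ exact self-similar VISCOUS solution**: if `Ω ∈ C² ∩ L¹`
  solves (Pν) at every `X`, then for every `T > 0` the ansatz `ω(t,x) = (T−t)⁻¹ Ω(x/(T−t)^{1/2})`
  (`gclmSelfSimilar (−1) (1/2) T Ω`) is a classical solution of the viscous gCLM with THE SAME `ν` on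
  `ℝ × [0,T)` (`IsGCLMLineSolution a ν ω T`) — the viscous term scales like the others precisely because
  `((T−t)^{1/2})² = T−t`; with `supNormBlowupBefore_gclmSelfSimilar` (tree) it blows up at `T` when `Ω ≢ 0`
  (`exact_viscous_selfSimilar_blowup_of_profile`).
* Relation to the tree's fact `chen2020_viscous_gCLM_blowup_near_half`: that theorem's blow-up (for `a` near
  `1/2`) is ASYMPTOTICALLY self-similar with `c_l → 1/3` and VANISHING rescaled viscosity; the present file is the
  complementary exact `c_l = 1/2` mechanism, for which no profile is known in print for any `a ≠ 0` (Schochet 1986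
  treats `a = 0` by explicit pole dynamics) — the cell's `E½` rows are numerical candidates for such profiles.

## References

* J. Chen, Nonlinearity 33 (2020) 2502 = arXiv:1908.09385: §1.2 (scaling, `γ = 2`), §2.1 (2.1)–(2.3)
  (dynamic rescaling, `ν(τ)`, steady states ⇔ self-similar solutions). [Chen2020DissipativeGCLM]
* D. Huang, X. Qin, X. Wang, D. Wei, ARMA 248 (2024) 22, eq. (1.2) (the ansatz `gclmSelfSimilar`).
  [HuangQinWangWei2024]
-/

noncomputable section

open _root_.MeasureTheory Set Filter
open scoped Real Topology

namespace Literature.Analysis.FluidPDE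

/-- The STEADY DYNAMIC-RESCALING EQUATION of the viscous gCLM at the parabolic scaling `(c_l, c_ω) = (1/2, −1)`
with constant rescaled viscosity `ν`, at the point `X`:
`(X/2 + a U(X))·Ω′(X) = (−1 + HΩ(X))·Ω(X) + ν·Ω″(X)`, `U = ∫₀^X HΩ` — the profile equation of an exactly
self-similar solution `ω = (T−t)⁻¹Ω(x/√(T−t))` of `ω_t + a u ω_x = u_x ω + ν ω_xx`.
[cite: Chen2020DissipativeGCLM, §2.1 eq. (2.2)–(2.3) (steady state, `c_ω + 2c_l = 0`)] -/
def ViscousGCLMProfileEqAt (a ν : ℝ) (Ω : ℝ → ℝ) (X : ℝ) : Prop :=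
  (1 / 2 * X + a * lineVelocity Ω X) * deriv Ω X = (-1 + lineHilbert Ω X) * Ω X + ν * iteratedDeriv 2 Ω X

/-- Unfolding `ViscousGCLMProfileEqAt`. [cite: Chen2020DissipativeGCLM, §2.1 eq. (2.2)] -/
theorem viscousGCLMProfileEqAt_iff (a ν : ℝ) (Ω : ℝ → ℝ) (X : ℝ) :
    ViscousGCLMProfileEqAt a ν Ω X ↔
      (1 / 2 * X + a * lineVelocity Ω X) * deriv Ω X =
        (-1 + lineHilbert Ω X) * Ω X + ν * iteratedDeriv 2 Ω X :=
  Iff.rfl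

/-- At `ν = 0`, (Pν) is the inviscid profile equation (2.1) of Huang–Qin–Wang–Wei with `c_l = 1/2`, `c_ω = −1`.
[cite: Chen2020DissipativeGCLM, §2.1 eq. (2.2)] -/
theorem viscousGCLMProfileEqAt_zero_iff (a : ℝ) (Ω : ℝ → ℝ) (X : ℝ) :
    ViscousGCLMProfileEqAt a 0 Ω X ↔ GCLMProfileEqAt a (1 / 2) (-1) Ω X := by
  rw [viscousGCLMProfileEqAt_iff, gclmProfileEqAt_iff, zero_mul, add_zero]

section Ansatz

variable {a ν T : ℝ} {Ω : ℝ → ℝ}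

/-- The first derivative of the slice as a function: `∂ₓ[ω(t,·)] = (T−t)⁻¹·L⁻¹·Ω′(L⁻¹·)`, `L = (T−t)^{c_l}`.
[cite: Chen2020DissipativeGCLM, §2.1 (2.1) (the rescaling)] -/
theorem deriv_gclmSelfSimilar_slice_fun {cl : ℝ} (t : ℝ) (hΩ : Differentiable ℝ Ω) :
    deriv (gclmSelfSimilar (-1) cl T Ω t) =
      fun x => (T - t)⁻¹ * (((T - t) ^ cl)⁻¹ * deriv Ω (((T - t) ^ cl)⁻¹ * x)) :=
  funext fun x => deriv_gclmSelfSimilar_slice t hΩ x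

/-- The SECOND derivative of the slice: `∂ₓ²[ω(t,·)](x) = (T−t)⁻¹·L⁻²·Ω″(X)`, `X = L⁻¹x`, `L = (T−t)^{c_l}`, for
`Ω ∈ C²`. [cite: Chen2020DissipativeGCLM, §2.1 (2.1)] -/
theorem iteratedDeriv_two_gclmSelfSimilar_slice {cl : ℝ} (t : ℝ) (hΩ2 : ContDiff ℝ 2 Ω) (x : ℝ) :
    iteratedDeriv 2 (gclmSelfSimilar (-1) cl T Ω t) x =
      (T - t)⁻¹ * (((T - t) ^ cl)⁻¹ ^ 2 * iteratedDeriv 2 Ω (((T - t) ^ cl)⁻¹ * x)) := by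
  have hΩd : Differentiable ℝ Ω := hΩ2.differentiable (by norm_num)
  have h2 : ContDiff ℝ (1 + 1) Ω := hΩ2
  rw [contDiff_succ_iff_deriv] at h2
  have hΩ'd : Differentiable ℝ (deriv Ω) := h2.2.2.differentiable one_ne_zero
  rw [iteratedDeriv_succ, iteratedDeriv_one, iteratedDeriv_succ, iteratedDeriv_one,
    deriv_gclmSelfSimilar_slice_fun t hΩd]
  set L : ℝ := (T - t) ^ cl with hL
  have h1 : HasDerivAt (fun y : ℝ => L⁻¹ * y) (L⁻¹ * 1) x := (hasDerivAt_id x).const_mul L⁻¹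
  have h2' : HasDerivAt (fun y : ℝ => deriv Ω (L⁻¹ * y)) (deriv (deriv Ω) (L⁻¹ * x) * (L⁻¹ * 1)) x :=
    ((hΩ'd (L⁻¹ * x)).hasDerivAt).comp x h1
  have h3 := (h2'.const_mul L⁻¹).const_mul (T - t)⁻¹
  rw [h3.deriv]
  ring

/-- The ansatz attains its datum: `t ↦ ω(t,x)` is continuous within `[0,∞)` at `t = 0` for every `x`
(the formula `(T−t)⁻¹Ω(x/(T−t)^{c_l})` is continuous at `t = 0 < T`). [cite: Chen2020DissipativeGCLM, §2.1 (2.1)] -/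
theorem continuousWithinAt_gclmSelfSimilar_zero {cl : ℝ} (hT : 0 < T) (hΩc : Continuous Ω) (x : ℝ) :
    ContinuousWithinAt (fun t => gclmSelfSimilar (-1) cl T Ω t x) (Ici 0) 0 := by
  refine ContinuousAt.continuousWithinAt ?_
  have h0 : T - 0 ≠ 0 := by simpa using hT.ne'
  have hsub : Continuous fun s : ℝ => T - s := continuous_const.sub continuous_id
  have hA : ContinuousAt (fun s : ℝ => (T - s) ^ (-1 : ℝ)) 0 :=
    (Real.continuousAt_rpow_const (T - 0) (-1) (Or.inl h0)).comp hsub.continuousAt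
  have hL : ContinuousAt (fun s : ℝ => (T - s) ^ cl) 0 :=
    (Real.continuousAt_rpow_const (T - 0) cl (Or.inl h0)).comp hsub.continuousAt
  have hLne : (fun s : ℝ => (T - s) ^ cl) 0 ≠ 0 := by
    simpa using (Real.rpow_pos_of_pos (by simpa using hT) cl).ne'
  have hX : ContinuousAt (fun s : ℝ => x / (T - s) ^ cl) 0 := continuousAt_const.div hL hLne
  have hΩX : ContinuousAt (fun s : ℝ => Ω (x / (T - s) ^ cl)) 0 := hΩc.continuousAt.comp hX
  have := hA.mul hΩX
  simpa [gclmSelfSimilar_def, Pi.mul_def] using this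

/-- **(Pν) ⇒ the parabolic ansatz is a classical solution of the VISCOUS gCLM** on `ℝ × [0,T)`, every `T > 0`:
if `Ω ∈ C² ∩ L¹(ℝ)` solves `(X/2 + aU)Ω′ = (−1 + HΩ)Ω + νΩ″` at every `X`, then
`ω(t,x) = (T−t)⁻¹Ω(x/(T−t)^{1/2})` satisfies `IsGCLMLineSolution a ν ω T` with the same `ν` — time derivative
`(T−t)⁻²(Ω + ½XΩ′)`, transport/stretching `(T−t)⁻²(−aUΩ′ + HΩ·Ω)` (dilation covariance of `H`, tree), and
viscosity `ν(T−t)⁻¹·((T−t)^{1/2})⁻²·Ω″ = (T−t)⁻²·νΩ″`, all at `X = x/(T−t)^{1/2}`.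
[cite: Chen2020DissipativeGCLM, §2.1 (steady states of (2.2) with (2.3) constant ⇔ exact self-similar solutions)] -/
theorem isGCLMLineSolution_viscousSelfSimilar (hT : 0 < T) (hΩ2 : ContDiff ℝ 2 Ω) (hΩi : Integrable Ω)
    (hP : ∀ X : ℝ, ViscousGCLMProfileEqAt a ν Ω X) :
    IsGCLMLineSolution a ν (gclmSelfSimilar (-1) (1 / 2) T Ω) T := by
  have hΩd : Differentiable ℝ Ω := hΩ2.differentiable (by norm_num)
  have hadm : HilbertPVAdmissible Ω := hilbertPVAdmissible_of_contDiff (hΩ2.of_le (by norm_num)) hΩi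
  refine ⟨fun t ht => ?_, fun x => continuousWithinAt_gclmSelfSimilar_zero hT hΩ2.continuous x,
    fun t ht x => ?_⟩
  · have hτ : 0 < T - t := sub_pos.2 ht.2
    have hL0 : (T - t) ^ (1 / 2 : ℝ) ≠ 0 := (Real.rpow_pos_of_pos hτ _).ne'
    rw [gclmSelfSimilar_slice t]
    refine ⟨contDiff_const.mul (hΩ2.comp (contDiff_const.mul contDiff_id)), ?_⟩
    exact (hΩi.comp_mul_left' (inv_ne_zero hL0)).const_mul _
  · have htT : t < T := ht.2
    have hτ : 0 < T - t := sub_pos.2 htT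
    have hτ0 : T - t ≠ 0 := hτ.ne'
    set L : ℝ := (T - t) ^ (1 / 2 : ℝ) with hLdef
    have hLpos : 0 < L := Real.rpow_pos_of_pos hτ _
    have hL0 : L ≠ 0 := hLpos.ne'
    have hL2 : L ^ 2 = T - t := by
      rw [hLdef, ← Real.rpow_natCast, ← Real.rpow_mul hτ.le]
      norm_num
    have hLinv2 : L⁻¹ ^ 2 = (T - t)⁻¹ := by rw [inv_pow, hL2]
    have hder := hasDerivAt_gclmSelfSimilar_time (cl := 1 / 2) htT hΩd x
    refine hder.congr_deriv ?_
    rw [deriv_gclmSelfSimilar_slice t hΩd, lineHilbert_gclmSelfSimilar_slice htT hadm,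
      lineVelocity_gclmSelfSimilar_slice htT hadm, iteratedDeriv_two_gclmSelfSimilar_slice t hΩ2]
    have hslice : gclmSelfSimilar (-1) (1 / 2) T Ω t x = (T - t)⁻¹ * Ω (L⁻¹ * x) := by
      rw [gclmSelfSimilar_slice t]
    rw [hslice, hLinv2]
    have hPX := hP (L⁻¹ * x)
    rw [viscousGCLMProfileEqAt_iff] at hPX
    have key : -(a * lineVelocity Ω (L⁻¹ * x)) * deriv Ω (L⁻¹ * x) +
        lineHilbert Ω (L⁻¹ * x) * Ω (L⁻¹ * x) + ν * iteratedDeriv 2 Ω (L⁻¹ * x) =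
        Ω (L⁻¹ * x) + 1 / 2 * (L⁻¹ * x) * deriv Ω (L⁻¹ * x) := by
      linear_combination (-1 : ℝ) * hPX
    rw [← key]
    field_simp
    ring

/-- **Exact self-similar VISCOUS blow-up from a profile**: a `C² ∩ L¹`, not identically zero solution of (Pν)
yields for every `T > 0` a classical solution of the viscous gCLM (same `ν`) on `ℝ × [0,T)` from the smooth `L¹`
datum `x ↦ T⁻¹Ω(x/√T)` whose sup norm blows up at `T` (`|ω(t, √(T−t)·X₀)| = |Ω(X₀)|/(T−t)`). This is the
statement an `E½` profile would instantiate; no such profile is asserted to exist.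
[cite: Chen2020DissipativeGCLM, §2.1] -/
theorem exact_viscous_selfSimilar_blowup_of_profile (hT : 0 < T) (hΩ2 : ContDiff ℝ 2 Ω) (hΩi : Integrable Ω)
    (hP : ∀ X : ℝ, ViscousGCLMProfileEqAt a ν Ω X) {X₀ : ℝ} (hX₀ : Ω X₀ ≠ 0) :
    IsGCLMLineSolution a ν (gclmSelfSimilar (-1) (1 / 2) T Ω) T ∧
      SupNormBlowupBefore (gclmSelfSimilar (-1) (1 / 2) T Ω) T :=
  ⟨isGCLMLineSolution_viscousSelfSimilar hT hΩ2 hΩi hP, supNormBlowupBefore_gclmSelfSimilar hT hX₀⟩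

end Ansatz

end Literature.Analysis.FluidPDE
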